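import Mathlib
import Summits.ValiantsHypothesis.ValiantsHypothesis.Theorems.ProofCarryingSymmetryRestorationQPESatEMul
import Summits.ValiantsHypothesis.ValiantsHypothesis.Theorems.ProofCarryingSymmetryRestorationQPESatUCEqCnorm

/-!
# Route ProofCarryingSymmetry — crux `RestorationQP`, line `registered`: e-saturated normal forms, part 4 —
hereditary saturation and the distributivity-free congruence

Support file for the crux item `stmt-ValiantsHypothesis-10343` (lead c5, cycle 5), continuing
`…ESatEMul` (laws of the peeled product) and `…ESatUCEqCnorm` (wave-1 stub).  For a GENERIC
instance `d`:

* every value of the e-saturation is a normal form ALL OF WHOSE SUBFORMULAS ARE ROOT-SATURATED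
  (`nf_esat`, `sat_esat`): products are only ever created by peeling (saturated at birth), by
  re-nesting saturated factor lists (sub-multisets stay saturated), inside the expansion `sig`
  (saturated by leaf counting), and smart sums create no products;
* consequently `esat d` RESPECTS THE DISTRIBUTIVITY-FREE CONGRUENCE:
  `UCEq F G → ACEq (esat d F) (esat d G)` (`acEq_esat_of_ucEq`) — smart sums and peeled smart
  products satisfy A2–A5, A7–A10 up to AC (A9 `a · 1 ↦ a` is where root saturation is needed).

Part 5 (`…ESatCR`) adds the ground equation itself.  Everything is elementary and proved.
-/

-- single-problem summit: `Summit.ValiantsHypothesis.ValiantsHypothesis.…` is the namespace by design (D-0017)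
set_option linter.dupNamespace false

noncomputable section

open scoped Classical

namespace Summit.ValiantsHypothesis.ValiantsHypothesis.Theorems

namespace ACStability

open Literature.Computability.AlgebraicComplexity ACClass

universe u v

variable {𝔽 : Type u} [Field 𝔽] {X : Type v} {d : DistData 𝔽 X}

/-! ### Root saturation of the nodes a smart operation creates -/

omit [Field 𝔽] in
/-- Subformulas of a left comb: a prefix comb, or a subformula of an entry. [folklore] -/
theorem subs_prodL (u : PIFormula 𝔽 X) (us : List (PIFormula 𝔽 X)) :
    ∀ J ∈ subs (prodL u us), (∃ n, J = prodL u (us.take n)) ∨ ∃ f ∈ u :: us, J ∈ subs f := by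
  induction us using List.reverseRecOn with
  | nil => intro J hJ; exact Or.inr ⟨u, by simp, hJ⟩
  | append_singleton ws w ih =>
    intro J hJ
    rw [prodL_append, prodL_nil] at hJ
    simp only [subs, List.mem_cons, List.mem_append] at hJ
    rcases hJ with h | h | h
    · refine Or.inl ⟨ws.length + 1, ?_⟩
      rw [h, List.take_of_length_le (by simp), prodL_append, prodL_nil]
    · rcases ih J h with ⟨n, hn⟩ | ⟨f, hf, hJf⟩
      · refine Or.inl ⟨min n ws.length, ?_⟩
        rw [hn, List.take_append_of_le_length (min_le_right _ _), ← List.take_take, List.take_length]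
      · exact Or.inr ⟨f, by simp at hf ⊢; tauto, hJf⟩
    · exact Or.inr ⟨w, by simp, h⟩

/-- A non-product has at most one root factor. [folklore] -/
theorem length_margs_le_one {x : PIFormula 𝔽 X} (h : headLabel x ≠ .mul) : (margs x).length ≤ 1 := by
  cases x with
  | var y => simp [margs_def, mulArgs]
  | const c => simp
  | add a b => simp [margs_def, mulArgs]
  | mul a b => simp at h

/-- Non-products are root-saturated. [folklore] -/
theorem sat_of_ne_mul (hg : d.Generic) {x : PIFormula 𝔽 X} (h : headLabel x ≠ .mul) :
    kmax (mset x) d.pat = 0 :=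
  kmax_mset_eq_zero_of_length_le hg (length_margs_le_one h)

/-- A prefix comb of a saturated factor list is root-saturated. [folklore] -/
theorem sat_prodL_take {l : List (PIFormula 𝔽 X)} (hl : ∀ f ∈ l, NF f ∧ constOf f = none ∧ headLabel f ≠ .mul)
    (hsat : kmax (Multiset.ofList (l.map mk)) d.pat = 0) {u : PIFormula 𝔽 X} {us : List (PIFormula 𝔽 X)}
    (hu : l = u :: us) (n : ℕ) : kmax (mset (prodL u (us.take n))) d.pat = 0 := by
  subst hu
  have hsub : ∀ f ∈ u :: us.take n, NF f ∧ constOf f = none ∧ headLabel f ≠ .mul := fun f hf => by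
    refine hl f ?_
    simp only [List.mem_cons] at hf ⊢
    exact hf.imp_right fun h => List.mem_of_mem_take h
  obtain ⟨-, hp⟩ := nf_prodL hsub
  rw [mset_def, hp.margs_eq.1, mulArgs_prodL fun f hf => (hsub f hf).2.2]
  refine Nat.eq_zero_of_le_zero (hsat ▸ kmax_mono ?_ d.pat)
  have : (u :: us.take n).Sublist (u :: us) := (List.take_sublist n us).cons_cons u
  exact (this.map mk).subperm

/-- The root factors of a smart product of normal forms, as a list. [folklore] -/
theorem margs_smul {a b : PIFormula 𝔽 X} (ha : NF a) (hb : NF b) (h : mcst a * mcst b ≠ 0) :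
    margs (smul a b) = margs a ++ margs b := by
  rw [mcst_def, mcst_def] at h
  rw [margs_def, margs_def, margs_def, msplit_smul_fst ha hb h]
  cases (msplit a).1 <;> cases (msplit b).1 <;> simp [mmerge, omulArgs, mulArgs]

/-- Root factors are subformulas. [folklore] -/
theorem mem_subs_of_mem_margs {x f : PIFormula 𝔽 X} (h : f ∈ margs x) : f ∈ subs x := by
  rw [margs_def] at h
  cases hm : (msplit x).1 with
  | none => rw [hm] at h; simp at h
  | some m =>
    rw [hm, omulArgs_some] at h
    exact subs_subset_of_mem (mem_subs_of_msplit hm) (mem_subs_of_mem_mulArgs h)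

/-- The merged factor node of a smart product of normal forms with non-vanishing constants has the
same root factor classes as the smart product. [folklore] -/
theorem sat_minner {a b : PIFormula 𝔽 X} (ha : NF a) (hb : NF b)
    (hsa : ∀ u ∈ subs a, kmax (mset u) d.pat = 0) (hsb : ∀ u ∈ subs b, kmax (mset u) d.pat = 0)
    (hroot : kmax (mset (smul a b)) d.pat = 0) : kmax (mset (minner a b)) d.pat = 0 := by
  unfold minner
  cases hma : (msplit a).1 with
  | none =>
    cases hmb : (msplit b).1 with
    | none => simp [mset_def, margs_def, kmax_zero_left d.pat_ne_zero]
    | some mb => simpa using hsb mb (mem_subs_of_msplit hmb)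
  | some ma =>
    cases hmb : (msplit b).1 with
    | none => simpa using hsa ma (mem_subs_of_msplit hma)
    | some mb =>
      simp only [mmerge_some_some, Option.getD_some]
      by_cases h0 : mcst a * mcst b = 0
      · -- impossible: both pure parts present means both constants are units? No — argue directly:
        -- a present pure part with constant 0 contradicts normality.
        exfalso
        rcases mul_eq_zero.1 h0 with h | h
        · have := ha.eq_const_zero_of_msplit h; rw [this] at hma; simp at hma
        · have := hb.eq_const_zero_of_msplit h; rw [this] at hmb; simp at hmb
      · have hp : MPure (.mul ma mb) := mpure_mul_iff.2 ⟨(ha.msplit_fst hma).2, (hb.msplit_fst hmb).2⟩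
        have e : mset (.mul ma mb) = mset (smul a b) := by
          rw [mset_def, mset_def, hp.margs_eq.1, margs_smul ha hb h0, margs_of_msplit hma,
            margs_of_msplit hmb, mulArgs_mul]
        rw [e]; exact hroot

/-- **Smart sums preserve hereditary saturation.** [folklore] -/
theorem sat_sadd (hg : d.Generic) {a b : PIFormula 𝔽 X}
    (hsa : ∀ u ∈ subs a, kmax (mset u) d.pat = 0) (hsb : ∀ u ∈ subs b, kmax (mset u) d.pat = 0) :
    ∀ u ∈ subs (sadd a b), kmax (mset u) d.pat = 0 := by
  -- the merged part is a sum, or a pure part of one argument, or a dummy constant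
  have hinner : kmax (mset (ainner a b)) d.pat = 0 := by
    unfold ainner
    cases hpa : (asplit a).1 with
    | none =>
      cases hpb : (asplit b).1 with
      | none => exact sat_of_ne_mul hg (by simp)
      | some pb => simpa using hsb pb (mem_subs_of_asplit hpb)
    | some pa =>
      cases hpb : (asplit b).1 with
      | none => simpa using hsa pa (mem_subs_of_asplit hpa)
      | some pb => exact sat_of_ne_mul hg (by simp)
  have hroot : kmax (mset (sadd a b)) d.pat = 0 := by
    rw [sadd_def]
    cases hm : amerge (asplit a).1 (asplit b).1 with
    | none => exact sat_of_ne_mul hg (by simp [amk])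
    | some m =>
      by_cases hc : (asplit a).2 + (asplit b).2 = 0
      · rw [hc, amk_some_zero]
        have : ainner a b = m := by rw [ainner, hm]; rfl
        rw [← this]; exact hinner
      · rw [amk_some_of_ne m hc]; exact sat_of_ne_mul hg (by simp)
  intro u hu
  rcases subs_sadd a b u hu with rfl | rfl | rfl | h | h
  · exact hroot
  · exact hinner
  · exact sat_of_ne_mul hg (by simp [aconst])
  · exact hsa u h
  · exact hsb u h

/-- Subformulas of the pieces of a generic instance are root-saturated (they are too small).
[folklore] -/
theorem DistData.Generic.sat_pieces (hg : d.Generic) :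
    (∀ u ∈ subs d.p, kmax (mset u) d.pat = 0) ∧ (∀ u ∈ subs d.q, kmax (mset u) d.pat = 0) ∧
      (∀ u ∈ subs d.r, kmax (mset u) d.pat = 0) := by
  have hs : nvars d.s = nvars d.q + nvars d.r := d.nvars_s
  have h1 := hg.1; have h2 := hg.2.1; have h3 := hg.2.2
  refine ⟨fun u hu => ?_, fun u hu => ?_, fun u hu => ?_⟩ <;>
    refine kmax_mset_eq_zero_of_nvars_lt d (lt_of_le_of_lt (nvars_le_of_mem_subs hu) ?_) <;>
    unfold DistData.patVars <;> omega

/-- No root factor of `q` (or of anything with fewer leaves than `s`) has the class of `s`.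
[folklore] -/
theorem count_mk_s_eq_zero {x : PIFormula 𝔽 X} (hx : nvars x < nvars d.s) : (mset x).count (mk d.s) = 0 := by
  rw [Multiset.count_eq_zero, mset_def]
  intro h
  obtain ⟨f, hf, e⟩ := List.mem_map.1 (Multiset.mem_coe.1 h)
  have := (mk_eq_mk.1 e).nvars_eq
  have := nvars_le_of_mem_margs hf
  omega

/-- **A product `p · x` with `x` smaller than `s` does not contain the pattern**: the class of `s`
is missing. [folklore] -/
theorem DistData.Generic.kmax_mset_p_add (hg : d.Generic) {x : PIFormula 𝔽 X} (hx : nvars x < nvars d.s) :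
    kmax (mset d.p + mset x) d.pat = 0 := by
  rw [kmax_eq_zero_iff d.pat_ne_zero]
  intro hle
  have hc := Multiset.le_iff_count.1 hle (ACClass.mk d.s)
  rw [Multiset.count_add, count_mk_s_eq_zero hx, add_zero] at hc
  -- the pattern has one more copy of `s` than `p` has
  have : d.pat.count (ACClass.mk d.s) = (mset d.p).count (ACClass.mk d.s) + 1 := by
    rw [DistData.pat, mset_def, DistData.patF, List.map_append, ← Multiset.coe_add, Multiset.count_add]
    simp
  have h1 := hg.1
  omega

/-- For a generic instance `nvars q < nvars s` and `nvars r < nvars s`. [folklore] -/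
theorem DistData.Generic.nvars_q_lt (hg : d.Generic) : nvars d.q < nvars d.s ∧ nvars d.r < nvars d.s := by
  rw [d.nvars_s]; have := hg.2.1; have := hg.2.2; omega

/-- **The smart products `p·q`, `p·r` do not peel.** [folklore] -/
theorem DistData.Generic.emul_p_q (hg : d.Generic) : emul d d.p d.q = smul d.p d.q ∧ emul d d.p d.r = smul d.p d.r := by
  obtain ⟨h1, h2⟩ := hg.mcst_mul_ne_zero
  constructor
  · rw [emul, epeel_of_saturated]
    rw [(mset_smul d.nf_p d.nf_q h1).1]; exact hg.kmax_mset_p_add hg.nvars_q_lt.1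
  · rw [emul, epeel_of_saturated]
    rw [(mset_smul d.nf_p d.nf_r h2).1]; exact hg.kmax_mset_p_add hg.nvars_q_lt.2

/-- **The expansion is hereditarily saturated.** [folklore] -/
theorem DistData.Generic.sat_sig (hg : d.Generic) : ∀ u ∈ subs d.sig, kmax (mset u) d.pat = 0 := by
  obtain ⟨hp, hq, hr⟩ := hg.sat_pieces
  obtain ⟨h1, h2⟩ := hg.mcst_mul_ne_zero
  have hpq : kmax (mset (smul d.p d.q)) d.pat = 0 := by
    rw [(mset_smul d.nf_p d.nf_q h1).1]; exact hg.kmax_mset_p_add hg.nvars_q_lt.1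
  have hpr : kmax (mset (smul d.p d.r)) d.pat = 0 := by
    rw [(mset_smul d.nf_p d.nf_r h2).1]; exact hg.kmax_mset_p_add hg.nvars_q_lt.2
  intro u hu
  rw [hg.sig_eq] at hu
  simp only [subs, List.mem_cons, List.mem_append] at hu
  rcases hu with rfl | hu | hu
  · exact sat_of_ne_mul hg (by simp)
  · rcases subs_smul d.p d.q u hu with rfl | rfl | rfl | h | h
    · exact hpq
    · exact sat_minner d.nf_p d.nf_q hp hq hpq
    · exact sat_of_ne_mul hg (by simp [mconst])
    · exact hp u h
    · exact hq u h
  · rcases subs_smul d.p d.r u hu with rfl | rfl | rfl | h | h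
    · exact hpr
    · exact sat_minner d.nf_p d.nf_r hp hr hpr
    · exact sat_of_ne_mul hg (by simp [mconst])
    · exact hp u h
    · exact hr u h

/-- **The peeled smart product preserves hereditary saturation.** [folklore] -/
theorem sat_emul (hg : d.Generic) {a b : PIFormula 𝔽 X} (ha : NF a) (hb : NF b)
    (hsa : ∀ u ∈ subs a, kmax (mset u) d.pat = 0) (hsb : ∀ u ∈ subs b, kmax (mset u) d.pat = 0) :
    ∀ u ∈ subs (emul d a b), kmax (mset u) d.pat = 0 := by
  intro u hu
  by_cases h0 : mcst a * mcst b = 0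
  · rw [emul_of_mcst_eq_zero h0] at hu
    simp only [subs, List.mem_singleton] at hu
    rw [hu]; exact sat_of_ne_mul hg (by simp)
  have hx : NF (smul a b) := nf_smul ha hb
  by_cases hk : kmax (mset (smul a b)) d.pat = 0
  · -- nothing peels: the smart product itself
    rw [emul, epeel_of_saturated hk] at hu
    rcases subs_smul a b u hu with rfl | rfl | rfl | h | h
    · exact hk
    · exact sat_minner ha hb hsa hsb hk
    · exact sat_of_ne_mul hg (by simp [mconst])
    · exact hsa u h
    · exact hsb u h
  · -- peeling: a re-nested saturated factor list with a nonzero constant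
    have hroot : kmax (mset (emul d a b)) d.pat = 0 := kmax_mset_emul hg ha hb
    have hl := peel_list_spec hg hx (kmax (mset (smul a b)) d.pat)
    have hmargs := margs_epeel hg hx hk
    rw [emul] at hu hroot
    rw [epeel_of_kmax_ne_zero d hk] at hu hroot hmargs
    set l := removeBy (margs (smul a b)) (kmax (mset (smul a b)) d.pat • d.pat) ++
      List.replicate (kmax (mset (smul a b)) d.pat) d.sig with hl_def
    rcases subs_mmk _ _ u hu with rfl | rfl | ⟨m, hm, hum⟩
    · exact hroot
    · exact sat_of_ne_mul hg (by simp)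
    · -- inside the comb
      cases hlu : l with
      | nil => rw [hlu] at hm; simp at hm
      | cons v vs =>
        rw [hlu, olist_cons, Option.some.injEq] at hm
        subst hm
        rcases subs_prodL v vs u hum with ⟨n, rfl⟩ | ⟨f, hf, huf⟩
        · refine sat_prodL_take hl ?_ hlu n
          rw [mset_def, hmargs] at hroot
          exact hroot
        · rw [← hlu] at hf
          rcases List.mem_append.1 hf with hf | hf
          · have hf' := mem_of_mem_removeBy hf
            rw [margs_smul ha hb h0] at hf'
            rcases List.mem_append.1 hf' with hf' | hf'
            · exact hsa u (subs_subset_of_mem (mem_subs_of_mem_margs hf') huf)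
            · exact hsb u (subs_subset_of_mem (mem_subs_of_mem_margs hf') huf)
          · rw [List.eq_of_mem_replicate hf] at huf
            exact hg.sat_sig u huf

/-! ### Values of the e-saturation -/

/-- **Every value of the e-saturation is a normal form all of whose subformulas are
root-saturated.** [folklore] -/
theorem nf_sat_esat (hg : d.Generic) (F : PIFormula 𝔽 X) :
    NF (esat d F) ∧ ∀ u ∈ subs (esat d F), kmax (mset u) d.pat = 0 := by
  induction F with
  | var x =>
    refine ⟨nf_var x, fun u hu => ?_⟩
    simp only [esat_var, subs, List.mem_singleton] at hu
    rw [hu]; exact sat_of_ne_mul hg (by simp)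
  | const c =>
    refine ⟨nf_const c, fun u hu => ?_⟩
    simp only [esat_const, subs, List.mem_singleton] at hu
    rw [hu]; exact sat_of_ne_mul hg (by simp)
  | add F G ihF ihG => exact ⟨nf_sadd ihF.1 ihG.1, sat_sadd hg ihF.2 ihG.2⟩
  | mul F G ihF ihG => exact ⟨nf_emul hg ihF.1 ihG.1, sat_emul hg ihF.1 ihG.1 ihF.2 ihG.2⟩

/-- Every value of the e-saturation is a normal form. [folklore] -/
theorem nf_esat (hg : d.Generic) (F : PIFormula 𝔽 X) : NF (esat d F) := (nf_sat_esat hg F).1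

/-- Every value of the e-saturation is root-saturated. [folklore] -/
theorem kmax_mset_esat (hg : d.Generic) (F : PIFormula 𝔽 X) : kmax (mset (esat d F)) d.pat = 0 :=
  (nf_sat_esat hg F).2 _ (mem_subs_self _)

/-! ### The distributivity-free congruence -/

/-- **The e-saturation respects `UCEq`**: formulas equal modulo associativity, commutativity, the
unit laws and the constant equations have AC-equivalent e-saturated normal forms. [folklore] -/
theorem acEq_esat_of_ucEq (hg : d.Generic) {F G : PIFormula 𝔽 X} (h : UCEq F G) :
    ACEq (esat d F) (esat d G) := by
  induction h with
  | refl F => exact .refl _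
  | symm _ ih => exact ih.symm
  | trans _ _ ih₁ ih₂ => exact ih₁.trans ih₂
  | add_congr _ _ ih₁ ih₂ =>
    rw [esat_add, esat_add]
    exact sadd_congr (nf_esat hg _) (nf_esat hg _) (nf_esat hg _) (nf_esat hg _) ih₁ ih₂
  | mul_congr _ _ ih₁ ih₂ =>
    rw [esat_mul, esat_mul]
    exact emul_congr hg (nf_esat hg _) (nf_esat hg _) (nf_esat hg _) (nf_esat hg _) ih₁ ih₂
  | add_comm F G => exact acEq_sadd_comm _ _
  | add_assoc F G H => exact acEq_sadd_assoc (nf_esat hg F) (nf_esat hg G) (nf_esat hg H)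
  | mul_comm F G => exact acEq_emul_comm hg (nf_esat hg F) (nf_esat hg G)
  | mul_assoc F G H => exact acEq_emul_assoc hg (nf_esat hg F) (nf_esat hg G) (nf_esat hg H)
  | add_zero F =>
    rw [esat_add, esat_const, sadd_const_zero (nf_esat hg F)]
    exact .refl _
  | mul_zero F =>
    rw [esat_mul, esat_const, emul_const_zero]
    exact .refl _
  | mul_one F =>
    rw [esat_mul, esat_const, emul_const_one (nf_esat hg F) (kmax_mset_esat hg F)]
    exact .refl _
  | const_add a b c h =>
    rw [esat_add, esat_const, esat_const, esat_const, sadd_const_const, ← h]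
    exact .refl _
  | const_mul a b c h =>
    rw [esat_mul, esat_const, esat_const, esat_const, emul_const_const, ← h]
    exact .refl _

end ACStability

end Summit.ValiantsHypothesis.ValiantsHypothesis.Theorems

end
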